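import Literature.RingTheory.Localization.QuotientRingEssentialExtension
import Literature.RingTheory.PrimeIdeals.GoldieRingsSupplements
import HarnessLib

/-!
# Uniform dimension of the left quotient ring as an `R`-module: `u dim _R Q = u dim _Q Q = u dim _R R` (McConnell–Robson 2.2.10 (ii), 2.2.12 (iv)(v))

Family `hodge`, lane `lit-hodgefound` (foundations library; seat `lit-hodgefound-p39`, generation 49, row g49-#19); topic
`RingTheory/Localization`, namespace `Literature.RingTheory.Localization`.  Uses row #18 (`R∙1 ≤ₑ R[S⁻¹]` as left `R`-modules), row #11
(`udim_top_oreLocalization : u dim _Q Q = u dim _R R`) and the module rows #1, #3, #5 (`IsEssential`, `HasFiniteUDim`, `udim`,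
`udim_map_of_injective`).

Sources, verbatim.  McConnell–Robson [McconnellRobson2001, Ch. 2 §2]: **2.10 Corollary.** «… (ii) … `N ◁ₑ M` if and only if `u dim N = u dim M`»
(for modules of finite uniform dimension); **2.12 Lemma.** «Let `𝒮` be a right Ore set of regular elements of a ring `R` and let `Q = R_𝒮`. … (iv)
`u dim B_Q = u dim B_R = u dim (B ∩ R)_R`; (v) `r u dim Q = r u dim R`.»

## What is formalised

* §1 (any module) **MR 2.2.10 (ii), the unconditional direction: an essential submodule has the uniform dimension of the whole module**:
  `hasFiniteUDim_top_of_isEssential` (finite uniform dimension passes from an essential submodule to the module) and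
  `udim_eq_udim_top_of_isEssential` (in `ℕ∞`, no finiteness hypothesis).
* §2 (left quotient rings, `S` left regular) **MR 2.2.12 (iv)(v) for `B = Q`: `u dim _R R[S⁻¹] = u dim _R R`** (`udim_top_restrictScalars_oreLocalization`:
  `R ≅ R∙1 ≤ₑ R[S⁻¹]`), hence **`u dim _Q Q = u dim _R Q`** (`udim_top_oreLocalization_eq_udim_top_restrictScalars`, with row #11), and `R[S⁻¹]` has
  finite uniform dimension as an `R`-module iff `R` does.

Theorems only; 0 `sorry`, no named fact (net debt 0, D-0026).

References.
* J. C. McConnell, J. C. Robson, *Noncommutative Noetherian Rings*, GSM 30, AMS (2001), Ch. 2 §2: Corollary 2.10 (ii), Lemma 2.12 (iv)(v).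
  [McconnellRobson2001]
-/

namespace Literature.RingTheory.Localization

open Function OreLocalization Literature.Algebra.Module Literature.RingTheory.PrimeIdeals

universe u v

/-! ## §1 MR 2.2.10 (ii): essential submodules have the uniform dimension of the module -/

section Module

variable {R : Type u} [Ring R] {M : Type v} [AddCommGroup M] [Module R M]

/-- **MR 2.2.10 (ii) (⟹, finiteness transfer): if an essential submodule `N` has finite uniform dimension then so has `M`** (an infinite
independent family `Xₙ` of nonzero submodules of `M` gives the infinite independent family `Xₙ ∩ N` of nonzero submodules of `N`).
[cite: McconnellRobson2001, Ch. 2 §2 Cor. 2.10 (ii)] -/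
theorem hasFiniteUDim_top_of_isEssential {N : Submodule R M} (hN : IsEssential N) (hfin : HasFiniteUDim N) :
    HasFiniteUDim (⊤ : Submodule R M) := by
  rw [hasFiniteUDim_iff_forall_nat] at hfin ⊢
  intro f _ hf0 hind
  exact hfin (fun n => f n ⊓ N) (fun n => inf_le_right) (fun n => hN.ne_bot (hf0 n)) (hind.mono fun n => inf_le_left)

/-- **MR 2.2.10 (ii) (⟹): an essential submodule has the same uniform dimension as the module** (in `ℕ∞`; both are `∞` when `N` has
infinite uniform dimension). [cite: McconnellRobson2001, Ch. 2 §2 Cor. 2.10 (ii)] -/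
theorem udim_eq_udim_top_of_isEssential {N : Submodule R M} (hN : IsEssential N) : udim N = udim (⊤ : Submodule R M) := by
  by_cases hfin : HasFiniteUDim N
  · exact (isEssential_iff_udim_eq_udim_top (hasFiniteUDim_top_of_isEssential hN hfin)).1 hN
  · rw [udim_eq_top_iff.2 hfin]
    exact (le_top.antisymm (udim_eq_top_iff.2 hfin ▸ udim_mono (le_top : N ≤ ⊤))).symm

end Module

/-! ## §2 MR 2.2.12 (iv)(v): the left quotient ring as an `R`-module -/

section OreSet

variable {R : Type u} [Ring R] {S : Submonoid R} [OreLocalization.OreSet S]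

/-- `r ↦ r/1 = r • 1` is an injective `R`-linear map `R → R[S⁻¹]` for `S` left regular. [cite: McconnellRobson2001, Ch. 2 §2 Lemma 2.12 (iv)] -/
theorem toSpanSingleton_one_injective (hS : S ≤ nonZeroDivisorsLeft R) :
    Injective (LinearMap.toSpanSingleton R R[S⁻¹] (1 : R[S⁻¹])) := by
  intro r₁ r₂ h
  simp only [LinearMap.toSpanSingleton_apply, smul_eq_oreDiv_one_mul, mul_one] at h
  exact numeratorHom_inj hS (by rw [numeratorHom_apply, numeratorHom_apply]; exact h)

/-- **MR 2.2.12 (iv)(v) for `B = Q`, left form: `u dim _R R[S⁻¹] = u dim _R R`** — as a left `R`-module the left quotient ring has the uniform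
dimension of `R` (`R ≅ R∙1 ≤ₑ R[S⁻¹]`, then 2.10 (ii)). [cite: McconnellRobson2001, Ch. 2 §2 Lemma 2.12 (iv)] -/
theorem udim_top_restrictScalars_oreLocalization (hS : S ≤ nonZeroDivisorsLeft R) :
    udim (⊤ : Submodule R R[S⁻¹]) = udim (⊤ : Submodule R R) := by
  rw [← udim_eq_udim_top_of_isEssential (isEssential_span_one hS), ← LinearMap.range_toSpanSingleton, ← Submodule.map_top,
    udim_map_of_injective (toSpanSingleton_one_injective hS)]

/-- **MR 2.2.12 (iv) for `B = Q`: `u dim _Q Q = u dim _R Q`** (both equal `u dim _R R`, row #11's `udim_top_oreLocalization`).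
[cite: McconnellRobson2001, Ch. 2 §2 Lemma 2.12 (iv)] -/
theorem udim_top_oreLocalization_eq_udim_top_restrictScalars (hS : S ≤ nonZeroDivisorsLeft R) :
    udim (⊤ : Submodule R[S⁻¹] R[S⁻¹]) = udim (⊤ : Submodule R R[S⁻¹]) := by
  rw [udim_top_oreLocalization hS, udim_top_restrictScalars_oreLocalization hS]

/-- `R[S⁻¹]` has finite uniform dimension as a left `R`-module iff `R` does. [cite: McconnellRobson2001, Ch. 2 §2 Lemma 2.12 (v)] -/
theorem hasFiniteUDim_top_restrictScalars_oreLocalization_iff (hS : S ≤ nonZeroDivisorsLeft R) :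
    HasFiniteUDim (⊤ : Submodule R R[S⁻¹]) ↔ HasFiniteUDim (⊤ : Submodule R R) := by
  rw [hasFiniteUDim_iff_udim_ne_top, hasFiniteUDim_iff_udim_ne_top, udim_top_restrictScalars_oreLocalization hS]

end OreSet

end Literature.RingTheory.Localization
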